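import Literature.AnabelianGeometry.EtaleTheta.Discharge.Sec5Prop53LabelsR
import Literature.AnabelianGeometry.EtaleTheta.Discharge.Sec5Prop53MonoidType
import Literature.AnabelianGeometry.EtaleTheta.ThetaFrobenioidOfTempered
import Literature.AlgebraicGeometry.Frobenioids.PerfFactorialPrimes
import Literature.AnabelianGeometry.EtaleTheta.ThetaFrobenioid

/-!
# [EtTh] Proposition 5.3 (ii), (iii): the "monoid type `ℤ`" hypothesis of the instance forms of record is
# UNSATISFIABLE when `Φ(A_⊚)` is perfect — as Proposition 5.1 asserts it is (vacuity certificate; FACT-LIST F-0559, F-0562)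

Mochizuki, *The étale theta function and its Frobenioid-theoretic manifestations*, Publ. RIMS **45** (2009):
Prop. 5.1 p.323 (PDF p.97) "The Frobenioid `C` is a tempered Frobenioid … whose monoid type is `ℤ`, and whose
divisor monoid `Φ(−)` is **perfect**, perf-factorial, non-dilating, and cuspidally pure"; Prop. 5.3 (ii), (iii)
p.325 (PDF p.99); Def. 3.6 (i), (ii) pp.302–303 (PDF pp.76–77); Prop. 3.2 (i) p.296 (PDF p.70); [FrdI] §0 p.11
("perfect": every `n`-th power map bijective) [cite: MochizukiEtTh2009, Prop 5.1 p.323 (PDF p.97)]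
[cite: MochizukiEtTh2009, Prop 5.3 p.325 (PDF p.99)] [cite: MochizukiFrdI2008, §0 p.11–12].

abc-iut cell, block F (fact-proving wave), seat abc-iut-f-127 = OWNER of tranche 127 (rows F-0559
`PreservesCspComponentIsos`, F-0561 `PreservesCuspidality`, …).  PROOF-ONLY companion (no `def`, no instance,
nothing landed is edited) of abc-iut-L2-d4's `Discharge/Sec5Prop53.lean` (`preservesNcspComponentIsos_of_monoidTypeZ`,
`preservesCspComponentIsos_of_monoidTypeZ` — the INSTANCE FORMS OF RECORD of F-0562 / F-0559, indexed by
`Summits/ABC/IUTFork/DAGL2t` as `N_EtTh_Prop5_3_ii/iii`), `Discharge/Sec5Prop53MonoidType.lean`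
(`DivisorSupportData.monoidTypeZ`) and abc-iut-L6-d1's repair `Discharge/Sec5Prop53LabelsR.lean`
(`DivisorSupportData'.monoidTypeZ'`).

WHAT IS PROVED (kernel statements about OUR typed hypotheses; nothing about the mathematics of [EtTh]):
* `Primes.exists_mul_self_eq_of_mem_submonoid_of_isPerfect` — in a PERFECT commutative monoid `M` ([FrdI] §0:
  `a ↦ a^n` bijective for all `n ≥ 1`) every element of a prime component `M_𝔭` (the submonoid generated by the
  primary elements of the `≼`-class `𝔭`, [FrdI] §0 p.12) is a SQUARE in `M_𝔭`: the square root `b` of a primary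
  `a` satisfies `b ≼ a ≼ b`, `b ≠ 1`, hence is primary of the same class (`Primes.mem_carrier_of_precsim`);
* `Primes.isEmpty_submonoid_mulEquiv_nat_of_isPerfect` — hence NO prime component of a perfect monoid is
  `≃* Multiplicative ℕ` (`1 ∈ ℕ` is not of the form `k + k`);
* `FrobenioidThetaDivisors.DivisorPrimeData.not_monoidTypeZHyp_of_isPerfect` — at every §5 datum `𝔉` whose
  divisor monoid `Φ(A_⊚)` is perfect, and for every `𝔓 : DivisorPrimeData 𝔉` (which supplies a prime), the
  hypothesis `hN : ∀ 𝔭, Nonempty (𝔭.submonoid ≃* Multiplicative ℕ)` of the two instance forms of record is FALSE;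
* `FrobenioidThetaDivisors.isEmpty_divisorSupportData'_of_isPerfect` / `…divisorSupportData_of_isPerfect` — at
  every such datum the support vocabularies `DivisorSupportData' 𝔓` (repair of record) and `DivisorSupportData 𝔓`
  are UNINHABITED (their field `factor_carrier` makes every `Φ(A_⊚)_𝔭` a copy of `ℤ_{≥0}`), so every theorem
  over `𝔖 : DivisorSupportData' 𝔓` (`…SupportOrders`, `…SupportIntersection`, `Sec5Prop53LabelsR/ThetaOrbit/
  MonoidType`, GAP G-L2d4-2) is vacuous there;
* `TemperedFrobenioid.isPerfect_phiAcirc_of_thetaStub` (+ two corollaries) — the cell's OWN model data meet the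
  premise: for §5 data over abc-iut-L2-t9's `thetaStub` of a tempered Frobenioid `C₀`, Prop. 5.1's clause
  "`Φ(−)` perfect" in L2-t9's reading (`thetaVocab.IsPerfect`, the `hperf` of `applicability_of_model`) gives
  `IsPerfect 𝔉.PhiAcirc`;
* `Example39Data.isPerfect_phiAcirc_thetaFrobenioid` (+ two corollaries) — at abc-iut-L2-t3's tempered Frobenioid of
  Example 3.9 (iv) (`E.thetaFrobenioid α h`, whose `Φ_α^ell` is perfect by the datum's field, Example 3.9 (iii)
  "perfect", `isPerfect_Φα`) NO hypothesis is left: for every §5 datum over its model stub and every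
  `DivisorPrimeData`, `hN` is false and `DivisorSupportData'` is empty.

READING RECORDED FOR THE OWNERS (neutral). Def. 3.6 (i)/(ii): the monoid type `Λ ∈ {ℤ, ℚ, ℝ}` of a tempered
Frobenioid is the `Λ` of `B := B^Λ_0|_D ×_{(Φ^{ℝ-log})^gp} Φ^gp`, `F := F^Λ_0` (rational-function / unit data);
the divisor monoid `Φ ⊆ Φ^{ℝ-log}` is a group-saturated perf-factorial subfunctor, in §5 (`Φ = Φ^ell_α`,
Example 3.9) a PERFECT one (Prop. 5.1) — Prop. 3.2 (i): `DIV_+(Z^log_∞)^pf` "is a direct product of copies of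
`ℚ_{≥0}`".  So `Φ(A_⊚)_𝔭 ≅ ℚ_{≥0}`, NOT `ℤ_{≥0}`, and print's "natural isomorphism `Φ(A_⊚)_𝔭 ⥲ Φ(A_⊚)_𝔮` —
determined by identifying the elements on each side that arise from [scheme-theoretic] prime log-divisors"
(p.325) PINS one isomorphism among the `ℚ_{>0}`-many; this is why (ii), (iii) have content in print, and why
they are automatic (`mulEquiv_eq_of_equiv_nat`) exactly under the hypothesis shown here to be unsatisfiable at
perfect data.  The toy of abc-iut-f-009 (`Sec5Prop53Toy`, `Φ := ⊕_{ℤ⊔ℤ} ℚ_{≥0}`) has the printed (perfect)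
shape.  A repair is the owners' call (e.g. `ℚ_{>0}`-valued coordinates of primary elements in `factor_carrier`
with the prime log-divisor `gen 𝔭` as a distinguished, not generating, element; (ii)/(iii) then read "`Ψ^Φ_{A_⊚}`
has one common `ℚ_{>0}`-scaling factor relative to the `gen`'s", which is geometric content, Rmk. 3.8.2).
v2 (append-only): appendix — prime components of a perfect monoid are PERFECT (`Primes.isPerfect_submonoid_of_isPerfect`),
`ℤ_{≥0}` is not (`not_isPerfect_multiplicative_nat`; cf. `Frobenioids.not_isPerfect_N` for the degree model).
HONEST FRAMING: vacuity-at-hypothesis ≠ falsity; Prop. 5.3 is neither proved nor refuted here; [EtTh] is a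
refereed paper; nothing here bears on [IUTchIII] Cor. 3.12 — no side is taken; typed ≠ proved.
-/

namespace Literature.AnabelianGeometry.EtaleTheta

open CategoryTheory Opposite
open Literature.AlgebraicGeometry.Frobenioids

universe w v v' u u'

/-! ### Prime components of a perfect monoid are `2`-divisible, hence never `ℤ_{≥0}` -/

section PerfectPrimes

variable {M : Type w} [CommMonoid M]

/-- In a perfect commutative monoid the square root of a primary element of the class `𝔭` is again a primary
element of the class `𝔭` ([FrdI] §0 p.12: `b ≼ a` and `b ≠ 1` for `b² = a` primary).
[cite: MochizukiFrdI2008, §0 p.11–12] -/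
theorem Primes.exists_mul_self_eq_of_mem_carrier_of_isPerfect (hM : IsPerfect M) (𝔭 : Primes M) {a : M}
    (ha : a ∈ 𝔭.carrier) : ∃ b ∈ 𝔭.carrier, b * b = a := by
  obtain ⟨b, hb⟩ := (hM.bijective_pow 2 two_pos).2 a
  dsimp only at hb
  rw [pow_two] at hb
  have hb1 : b ≠ 1 := by
    rintro rfl
    obtain ⟨ha', -⟩ := ha
    exact ha'.1 (by rw [← hb, one_mul])
  exact ⟨b, Primes.mem_carrier_of_precsim 𝔭 ha hb1 (Precsim.of_dvd ⟨b, hb.symm⟩), hb⟩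

/-- **Every element of a prime component `M_𝔭` of a PERFECT commutative monoid is a square in `M_𝔭`**
(`M_𝔭` = the submonoid generated by the primary elements of `𝔭`, [FrdI] §0 p.12).
[cite: MochizukiFrdI2008, §0 p.11–12] -/
theorem Primes.exists_mul_self_eq_of_mem_submonoid_of_isPerfect (hM : IsPerfect M) (𝔭 : Primes M) {x : M}
    (hx : x ∈ 𝔭.submonoid) : ∃ y ∈ 𝔭.submonoid, y * y = x := by
  induction hx using Submonoid.closure_induction with
  | mem a ha =>
    obtain ⟨b, hb, hbb⟩ := Primes.exists_mul_self_eq_of_mem_carrier_of_isPerfect hM 𝔭 ha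
    exact ⟨b, Submonoid.subset_closure hb, hbb⟩
  | one => exact ⟨1, one_mem _, one_mul 1⟩
  | mul a a' _ _ iha iha' =>
    obtain ⟨y, hy, rfl⟩ := iha
    obtain ⟨y', hy', rfl⟩ := iha'
    exact ⟨y * y', mul_mem hy hy', mul_mul_mul_comm y y' y y'⟩

/-- **No prime component of a perfect commutative monoid is a copy of `ℤ_{≥0}`** (`Multiplicative ℕ`): the
generator `1` of `ℤ_{≥0}` is not a double.  [cite: MochizukiFrdI2008, §0 p.11–12] -/
theorem Primes.isEmpty_submonoid_mulEquiv_nat_of_isPerfect (hM : IsPerfect M) (𝔭 : Primes M) :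
    IsEmpty (𝔭.submonoid ≃* Multiplicative ℕ) := by
  refine ⟨fun e => ?_⟩
  obtain ⟨y, hy, hyy⟩ :=
    Primes.exists_mul_self_eq_of_mem_submonoid_of_isPerfect hM 𝔭 (e.symm (Multiplicative.ofAdd 1)).2
  have h : e ⟨y, hy⟩ * e ⟨y, hy⟩ = Multiplicative.ofAdd 1 := by
    rw [← map_mul, ← e.apply_symm_apply (Multiplicative.ofAdd 1)]
    exact congrArg e (Subtype.ext hyy)
  have h' := congrArg Multiplicative.toAdd h
  rw [toAdd_mul, toAdd_ofAdd] at h'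
  omega

/-- Hence, as soon as ONE prime exists, it is false that every prime component is `≃* Multiplicative ℕ`.
[cite: MochizukiFrdI2008, §0 p.11–12] -/
theorem Primes.not_forall_nonempty_submonoid_mulEquiv_nat_of_isPerfect (hM : IsPerfect M) (𝔭 : Primes M) :
    ¬ ∀ 𝔮 : Primes M, Nonempty (𝔮.submonoid ≃* Multiplicative ℕ) :=
  fun h => (Primes.isEmpty_submonoid_mulEquiv_nat_of_isPerfect hM 𝔭).false (h 𝔭).some

end PerfectPrimes

/-! ### At §5 data with perfect `Φ(A_⊚)`: the hypothesis `hN` and the support vocabularies -/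

namespace FrobenioidThetaDivisors

variable {C : Type u} [Category.{v} C] {D : Type u'} [Category.{v'} D] {𝔉 : ThetaFrobenioid.{w} C D}

/-- **The "monoid type `ℤ`" hypothesis `hN` of `preservesNcspComponentIsos_of_monoidTypeZ` /
`preservesCspComponentIsos_of_monoidTypeZ` (instance forms of record of F-0562 / F-0559) is UNSATISFIABLE at
every §5 datum whose divisor monoid `Φ(A_⊚)` is perfect** — Prop. 5.1: "whose divisor monoid `Φ(−)` is
perfect" — for every `DivisorPrimeData` (which supplies the non-cuspidal prime labelled `0`).
[cite: MochizukiEtTh2009, Prop 5.1 p.323 (PDF p.97); Prop 5.3 (ii)(iii) p.325 (PDF p.99)] -/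
theorem DivisorPrimeData.not_monoidTypeZHyp_of_isPerfect (𝔓 : DivisorPrimeData 𝔉) (hΦ : IsPerfect 𝔉.PhiAcirc) :
    ¬ ∀ 𝔭 : Primes 𝔉.PhiAcirc, Nonempty (𝔭.submonoid ≃* Multiplicative ℕ) :=
  Primes.not_forall_nonempty_submonoid_mulEquiv_nat_of_isPerfect hΦ (𝔓.ncspEquivZ.symm 0).1

/-- **The repaired support vocabulary `DivisorSupportData'` is UNINHABITED at every §5 datum with perfect
`Φ(A_⊚)`** (its `factor_carrier` makes `Φ(A_⊚)_𝔭 ≅ ℤ_{≥0}`, `monoidTypeZ'`): every theorem taking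
`𝔖 : DivisorSupportData' 𝔓` is vacuous there.  [cite: MochizukiEtTh2009, Prop 5.1 p.323 (PDF p.97); Prop 5.3 proof p.326 (PDF p.100)] -/
theorem isEmpty_divisorSupportData'_of_isPerfect (𝔓 : DivisorPrimeData 𝔉) (hΦ : IsPerfect 𝔉.PhiAcirc) :
    IsEmpty (DivisorSupportData' 𝔓) :=
  ⟨fun 𝔖 => 𝔓.not_monoidTypeZHyp_of_isPerfect hΦ 𝔖.monoidTypeZ'⟩

/-- The same for the support vocabulary of record `DivisorSupportData` (uninhabited for an independent reason
— finitely supported coordinates — by abc-iut-L6-d1's `FrobenioidThetaDivisorSupportNegative`).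
[cite: MochizukiEtTh2009, Prop 5.1 p.323 (PDF p.97); Prop 5.3 proof p.326 (PDF p.100)] -/
theorem isEmpty_divisorSupportData_of_isPerfect (𝔓 : DivisorPrimeData 𝔉) (hΦ : IsPerfect 𝔉.PhiAcirc) :
    IsEmpty (DivisorSupportData 𝔓) :=
  ⟨fun 𝔖 => 𝔓.not_monoidTypeZHyp_of_isPerfect hΦ 𝔖.monoidTypeZ⟩

/-- Restated at the level of the two instance forms: at perfect `Φ(A_⊚)` with a `DivisorPrimeData`, the pair
(hypothesis `hN`, conclusion) of `preservesCspComponentIsos_of_monoidTypeZ` can only be USED vacuously — there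
is no `hN` to feed it.  (Bookkeeping form for the FACT-LIST «instance form» column of F-0559 / F-0562.)
[cite: MochizukiEtTh2009, Prop 5.3 (iii) p.325 (PDF p.99)] -/
theorem DivisorPrimeData.isEmpty_monoidTypeZHyp_of_isPerfect (𝔓 : DivisorPrimeData 𝔉) (hΦ : IsPerfect 𝔉.PhiAcirc) :
    IsEmpty (∀ 𝔭 : Primes 𝔉.PhiAcirc, Nonempty (𝔭.submonoid ≃* Multiplicative ℕ)) :=
  ⟨fun hN => 𝔓.not_monoidTypeZHyp_of_isPerfect hΦ hN⟩

end FrobenioidThetaDivisors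

/-! ### The cell's model data meet the premise: Prop. 5.1's "`Φ(−)` perfect" gives `IsPerfect Φ(A_⊚)` -/

namespace TemperedFrobenioid

universe u₀ v₀ u₁ v₁

variable {D₀ : Type u₀} [Category.{v₀} D₀] {V : FrdIMonoidStub.{w}}
  {T : RealifiedDivisorMonoids (D₀ := D₀) V} {D : Type u₁} [Category.{v₁} D]
  {VD : FrdICatStub.{u₁, v₁, w} D} {C₀ : TemperedFrobenioid T D VD}

/-- **For §5 data over the model of a tempered Frobenioid `C₀` (abc-iut-L2-t9's `thetaStub`), Prop. 5.1's clause
"whose divisor monoid `Φ(−)` is perfect" — in L2-t9's reading `∀ A, IsPerfect (C₀.Φ.carrier A)`, the `hperf` of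
`applicability_of_model` / the `IsPerfect` field of `thetaVocab` — makes `Φ(A_⊚)` perfect.**
[cite: MochizukiEtTh2009, Prop 5.1 p.323 (PDF p.97)] -/
theorem isPerfect_phiAcirc_of_thetaStub (𝔉 : ThetaFrobenioid.{w} C₀.category D)
    {hΦ : ∀ A : Dᵒᵖ, IsIntegral (C₀.Φ.carrier A)} {IsBFT : MorphismProperty C₀.category}
    (h𝔉 : 𝔉.toTemperedFrobenioidStub = C₀.thetaStub hΦ IsBFT)
    (hperf : ∀ A : Dᵒᵖ, IsPerfect (C₀.Φ.carrier A)) : IsPerfect 𝔉.PhiAcirc := by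
  have key : ∀ S : FrobenioidTheta.TemperedFrobenioidStub.{w} C₀.category D, S = C₀.thetaStub hΦ IsBFT →
      ∀ X : C₀.category, IsPerfect (S.pre.Mon (S.pre.base.obj X)) := by
    rintro _ rfl X
    exact hperf _
  exact key _ h𝔉 𝔉.Acirc

/-- Hence, at such model data, the hypothesis `hN` of the instance forms of record of Prop. 5.3 (ii)/(iii) is
unsatisfiable for every `DivisorPrimeData`.  [cite: MochizukiEtTh2009, Prop 5.1 p.323 (PDF p.97); Prop 5.3 (ii)(iii) p.325 (PDF p.99)] -/
theorem not_monoidTypeZHyp_of_thetaStub (𝔉 : ThetaFrobenioid.{w} C₀.category D)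
    {hΦ : ∀ A : Dᵒᵖ, IsIntegral (C₀.Φ.carrier A)} {IsBFT : MorphismProperty C₀.category}
    (h𝔉 : 𝔉.toTemperedFrobenioidStub = C₀.thetaStub hΦ IsBFT)
    (hperf : ∀ A : Dᵒᵖ, IsPerfect (C₀.Φ.carrier A))
    (𝔓 : FrobenioidThetaDivisors.DivisorPrimeData 𝔉) :
    ¬ ∀ 𝔭 : Primes 𝔉.PhiAcirc, Nonempty (𝔭.submonoid ≃* Multiplicative ℕ) :=
  𝔓.not_monoidTypeZHyp_of_isPerfect (isPerfect_phiAcirc_of_thetaStub 𝔉 h𝔉 hperf)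

/-- … and the support vocabulary `DivisorSupportData'` has no instance at such model data.
[cite: MochizukiEtTh2009, Prop 5.1 p.323 (PDF p.97); Prop 5.3 proof p.326 (PDF p.100)] -/
theorem isEmpty_divisorSupportData'_of_thetaStub (𝔉 : ThetaFrobenioid.{w} C₀.category D)
    {hΦ : ∀ A : Dᵒᵖ, IsIntegral (C₀.Φ.carrier A)} {IsBFT : MorphismProperty C₀.category}
    (h𝔉 : 𝔉.toTemperedFrobenioidStub = C₀.thetaStub hΦ IsBFT)
    (hperf : ∀ A : Dᵒᵖ, IsPerfect (C₀.Φ.carrier A))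
    (𝔓 : FrobenioidThetaDivisors.DivisorPrimeData 𝔉) :
    IsEmpty (FrobenioidThetaDivisors.DivisorSupportData' 𝔓) :=
  FrobenioidThetaDivisors.isEmpty_divisorSupportData'_of_isPerfect 𝔓 (isPerfect_phiAcirc_of_thetaStub 𝔉 h𝔉 hperf)

end TemperedFrobenioid

/-! ### Example 3.9 (iv): at the tree's tempered Frobenioid of a Tate curve datum, no hypothesis is left -/

namespace Example39Data

universe u₂ v₂

variable {V : FrdIMonoidStub.{w}} {DW : Type u₂} [Category.{v₂} DW] {TW : RealifiedDivisorMonoids (D₀ := DW) V}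
  (E : Example39Data V DW TW) {A B : DW} (α : A ⟶ B)

/-- **`Φ(A_⊚)` is perfect for every §5 datum over the model stub of the Example 3.9 (iv) tempered Frobenioid
`E.thetaFrobenioid α h`** — `Φ_α^ell` "is perfect" (Example 3.9 (iii)/(iv), p.311 (PDF p.85); the datum's field,
`isPerfect_Φα`).  [cite: MochizukiEtTh2009, Ex 3.9 p.311 (PDF p.85); Prop 5.1 p.323 (PDF p.97)] -/
theorem isPerfect_phiAcirc_thetaFrobenioid {VD : FrdICatStub.{max u₂ v₂, v₂, w} (Dα α)} (h : E.FrobenioidHyp α VD)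
    (𝔉 : ThetaFrobenioid.{w} (E.thetaFrobenioid α h).category (Dα α))
    {hΦ : ∀ X : (Dα α)ᵒᵖ, IsIntegral ((E.thetaFrobenioid α h).Φ.carrier X)}
    {IsBFT : MorphismProperty (E.thetaFrobenioid α h).category}
    (h𝔉 : 𝔉.toTemperedFrobenioidStub = (E.thetaFrobenioid α h).thetaStub hΦ IsBFT) :
    IsPerfect 𝔉.PhiAcirc :=
  TemperedFrobenioid.isPerfect_phiAcirc_of_thetaStub 𝔉 h𝔉 fun X => E.isPerfect_Φα α X

/-- Hence at the Example 3.9 (iv) model the hypothesis `hN` («every `Φ(A_⊚)_𝔭 ≃ ℤ_{≥0}`») of the Prop. 5.3 (ii)/(iii)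
instance forms of record fails for every `DivisorPrimeData`.  [cite: MochizukiEtTh2009, Prop 5.3 (ii)(iii) p.325 (PDF p.99)] -/
theorem not_monoidTypeZHyp_thetaFrobenioid {VD : FrdICatStub.{max u₂ v₂, v₂, w} (Dα α)} (h : E.FrobenioidHyp α VD)
    (𝔉 : ThetaFrobenioid.{w} (E.thetaFrobenioid α h).category (Dα α))
    {hΦ : ∀ X : (Dα α)ᵒᵖ, IsIntegral ((E.thetaFrobenioid α h).Φ.carrier X)}
    {IsBFT : MorphismProperty (E.thetaFrobenioid α h).category}
    (h𝔉 : 𝔉.toTemperedFrobenioidStub = (E.thetaFrobenioid α h).thetaStub hΦ IsBFT)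
    (𝔓 : FrobenioidThetaDivisors.DivisorPrimeData 𝔉) :
    ¬ ∀ 𝔭 : Primes 𝔉.PhiAcirc, Nonempty (𝔭.submonoid ≃* Multiplicative ℕ) :=
  𝔓.not_monoidTypeZHyp_of_isPerfect (E.isPerfect_phiAcirc_thetaFrobenioid α h 𝔉 h𝔉)

/-- … and `DivisorSupportData'` has no instance at the Example 3.9 (iv) model.
[cite: MochizukiEtTh2009, Prop 5.3 proof p.326 (PDF p.100)] -/
theorem isEmpty_divisorSupportData'_thetaFrobenioid {VD : FrdICatStub.{max u₂ v₂, v₂, w} (Dα α)}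
    (h : E.FrobenioidHyp α VD) (𝔉 : ThetaFrobenioid.{w} (E.thetaFrobenioid α h).category (Dα α))
    {hΦ : ∀ X : (Dα α)ᵒᵖ, IsIntegral ((E.thetaFrobenioid α h).Φ.carrier X)}
    {IsBFT : MorphismProperty (E.thetaFrobenioid α h).category}
    (h𝔉 : 𝔉.toTemperedFrobenioidStub = (E.thetaFrobenioid α h).thetaStub hΦ IsBFT)
    (𝔓 : FrobenioidThetaDivisors.DivisorPrimeData 𝔉) :
    IsEmpty (FrobenioidThetaDivisors.DivisorSupportData' 𝔓) :=
  FrobenioidThetaDivisors.isEmpty_divisorSupportData'_of_isPerfect 𝔓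
    (E.isPerfect_phiAcirc_thetaFrobenioid α h 𝔉 h𝔉)

end Example39Data

/-! ### Appendix (v2, append-only): prime components of a perfect monoid are themselves perfect -/

section PerfectPrimesAppendix

variable {M : Type w} [CommMonoid M]

/-- In a perfect commutative monoid, every element of a prime component `M_𝔭` has an `n`-th root in `M_𝔭` for
every `n ≥ 1` (the `n`-th root of a primary `a` is `≼ a`, `≠ 1`, hence primary of the same class).
[cite: MochizukiFrdI2008, §0 p.11–12] -/
theorem Primes.exists_pow_eq_of_mem_submonoid_of_isPerfect (hM : IsPerfect M) (𝔭 : Primes M) {n : ℕ}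
    (hn : 0 < n) {x : M} (hx : x ∈ 𝔭.submonoid) : ∃ y ∈ 𝔭.submonoid, y ^ n = x := by
  induction hx using Submonoid.closure_induction with
  | mem a ha =>
    obtain ⟨b, hb⟩ := (hM.bijective_pow n hn).2 a
    dsimp only at hb
    have hb1 : b ≠ 1 := by
      rintro rfl
      obtain ⟨ha', -⟩ := ha
      exact ha'.1 (by rw [← hb, one_pow])
    exact ⟨b, Submonoid.subset_closure
      (Primes.mem_carrier_of_precsim 𝔭 ha hb1 (Precsim.of_dvd (hb ▸ dvd_pow_self b hn.ne'))), hb⟩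
  | one => exact ⟨1, one_mem _, one_pow n⟩
  | mul a a' _ _ iha iha' =>
    obtain ⟨y, hy, rfl⟩ := iha
    obtain ⟨y', hy', rfl⟩ := iha'
    exact ⟨y * y', mul_mem hy hy', mul_pow y y' n⟩

/-- **Prime components of a perfect commutative monoid are perfect** ([FrdI] §0: `a ↦ a^n` is bijective on
`M_𝔭` for every `n ≥ 1`) — so at data meeting [EtTh] Prop. 5.1's "`Φ(−)` perfect" each `Φ(A_⊚)_𝔭` is a perfect
monoid (print: a copy of `ℚ_{≥0}`, Prop. 3.2 (i)), never `ℤ_{≥0}`.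
[cite: MochizukiFrdI2008, §0 p.11–12] [cite: MochizukiEtTh2009, Prop 3.2 (i) p.296 (PDF p.70)] -/
theorem Primes.isPerfect_submonoid_of_isPerfect (hM : IsPerfect M) (𝔭 : Primes M) : IsPerfect 𝔭.submonoid := by
  refine ⟨fun n hn => ⟨fun x y hxy => ?_, fun x => ?_⟩⟩
  · apply Subtype.ext
    apply (hM.bijective_pow n hn).1
    simpa only [SubmonoidClass.coe_pow] using congrArg Subtype.val hxy
  · obtain ⟨y, hy, hyx⟩ := Primes.exists_pow_eq_of_mem_submonoid_of_isPerfect hM 𝔭 hn x.2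
    exact ⟨⟨y, hy⟩, Subtype.ext (by simpa only [SubmonoidClass.coe_pow] using hyx)⟩

/-- `ℤ_{≥0}` (`Multiplicative ℕ`) is not perfect: `1` is not a double (same computation as
`Frobenioids.not_isPerfect_N` for the degree model `DegreeModel.N`). [cite: MochizukiFrdI2008, §0 p.11] -/
theorem not_isPerfect_multiplicative_nat : ¬ IsPerfect (Multiplicative ℕ) := by
  intro h
  obtain ⟨b, hb⟩ := (h.bijective_pow 2 two_pos).2 (Multiplicative.ofAdd 1)
  have h' := congrArg Multiplicative.toAdd hb
  dsimp only at h'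
  rw [toAdd_pow, toAdd_ofAdd, smul_eq_mul] at h'
  omega

end PerfectPrimesAppendix

end Literature.AnabelianGeometry.EtaleTheta
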